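import Summits.Ventures.YMGap.SlabAreaLawSU3Radius
import Summits.Ventures.YMGap.SlabAreaLawDimensions
import HarnessLib

/-!
# Venture YMGap, track (a) / A4 — the `SU(3)` slab door at radius `3/5` in EVERY dimension `d ≥ 2`:
# Wilson AREA LAW for all `0 ≤ β_W ≤ 27/(10(d−1))`, conditional on the radius-`3/5` certificate pair

HONEST FRAMING: venture file of the cell `pub-ymgap` (QuantumFields programme), seat engine-2 (g4).  Kernel ARITHMETIC over tree theorems,
nothing else: p1's generic slab door `Slab.hasAreaLaw_of_oneLinkKRModulus` (every `d ≥ 2`, every `N ≥ 2`; Durhuus–Fröhlich / Cao–Nissim–Sheffield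
criterion = the tree theorem `durhuusFrohlich_areaLaw_of_slabClustering_holds`) fed with `pub-balaban`'s Poincaré–variance one-link modulus
`oneLinkKRModulus_of_poincare_of_varianceBound` at the radius-`3/5` pair — the SAME two displayed hypotheses as the cell's booked `d = 4` row
`Slab.su3_hasAreaLaw_le_nineTenths_of_poincare_of_varianceBound` (`SlabAreaLawSU3Radius`, engine-2 g3):
`OneLinkPoincareSUN 3 (3/5) (4/5)` (H1; certified by two full ball-arithmetic engines, `pub-ymgap` kit j165229 + j165250–253) and
`OneLinkVarianceBound 3 (3/5) (17/5)` (H2; one full engine + one part of the second + cross-evaluation at filing — class «K × C⁻» in the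
cell's books).  Finite-dimensional inequalities about ONE tilted Haar law on `SU(3)`; NOTHING is asserted about them here.

WHAT THIS LEAF DOES.  The one-link law of a slab link in dimension `d` is tilted by `2(d−1)` plaquettes, so the tilt radius is
`R = 2(d−1)·β_W/9` ('t Hooft `β_W/9`); the modulus `K = √((4/5)(17/5)) = √(68/25) ≤ 33/20` is valid on `R ≤ 3/5`, i.e. for
`(d−1)β_W ≤ 27/10`, and there the slab Dobrushin constant `2(d−1)(β_W/9)·K ≤ (3/5)(33/20) = 99/100 < 1`: the row is capped by the certified
RADIUS in every dimension (as at `d = 4`).  Hence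

* `su3_hasAreaLaw_dim_of_nineTenths_pair`: H1 ∧ H2 ⇒ `HasAreaLaw d (fundamentalRep (Fin 3)) (β_W/3)` for every `d ≥ 2` and every
  `0 ≤ β_W` with `(d−1)β_W ≤ 27/10` — `d = 3`: `β_W ≤ 27/20 = 1.35`; `d = 4`: `9/10` (the booked row, re-derived); `d = 5`: `27/40`; `d = 6`: `27/50`;
* for comparison, in the tree: `SU(3)` at `(d−1)β_W ≤ 33/20` given the variance certificate `OneLinkVarianceBound 3 (11/30) (49/20)` alone
  (`SlabAreaLawDimensions.su3_hasAreaLaw_of_varianceBound_dim`, K × C-iv: `d = 3`: `33/40`, `d = 5`: `33/80`); printed CNS25 Thm. 1.6 `β_W < 9/(8(d−1))`;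
  `SU(2)` unconditional `(d−1)β_W < 2`.  Ratio to print: `×12/5` in every `d`.
Class when booked: the class of the `d = 4` row (same hypotheses).  Strong-coupling LATTICE statements only; no continuum limit, no mass-gap or
Clay claim.
-/

noncomputable section

open Literature.MathematicalPhysics.QuantumLattice (fundamentalRep)
open Literature.MathematicalPhysics.QuantumFieldTheory
open Literature.MathematicalPhysics.QuantumFieldTheory.Balaban1983to89.StrongCouplingDobrushinWindow (OneLinkKRModulus)
open Summit.QuantumFields.BalabanUV.InfraRed.StrongCouplingVarianceDoorSUN (OneLinkVarianceBound)
open Summit.QuantumFields.BalabanUV.InfraRed.StrongCouplingPoincareDoorSUN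
  (OneLinkPoincareSUN oneLinkKRModulus_of_poincare_of_varianceBound)
open Summit.Ventures.YMGap.Slab (hasAreaLaw_of_oneLinkKRModulus)

namespace Summit.Ventures.YMGap.SlabSU3RadiusDim

/-- ★ **`SU(3)` Wilson AREA LAW IN EVERY DIMENSION `d ≥ 2` for `0 ≤ β_W ≤ 27/(10(d−1))` — CONDITIONAL on the radius-`3/5` pair**
H1 `OneLinkPoincareSUN 3 (3/5) (4/5)`, H2 `OneLinkVarianceBound 3 (3/5) (17/5)` (the displayed hypotheses of the cell's `d = 4` row
`Slab.su3_hasAreaLaw_le_nineTenths_of_poincare_of_varianceBound`; certified computations, NOT proved here).  't Hooft `β = β_W/9`, tree coupling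
`β_W/3`, slab radius `2(d−1)β_W/9 ≤ 3/5`, modulus `√(68/25) ≤ 33/20`, slab constant `2(d−1)(β_W/9)·√(68/25) ≤ 99/100 < 1`; DF criterion = tree theorem.
`d = 3`: `β_W ≤ 27/20`; `d = 4`: `9/10`; `d = 5`: `27/40`; `d = 6`: `27/50`.  Printed CNS25 Thm. 1.6: `β_W < 9/(8(d−1))` (`×12/5`).
[cite: CaoNissimSheffield2025dynamical, Theorems 1.6 and 2.3] -/
theorem su3_hasAreaLaw_dim_of_nineTenths_pair {d : ℕ} (hd : 2 ≤ d) (hP : OneLinkPoincareSUN 3 (3 / 5) (4 / 5))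
    (hv : OneLinkVarianceBound 3 (3 / 5) (17 / 5)) {βW : ℝ} (hβ : 0 ≤ βW) (hle : ((d : ℝ) - 1) * βW ≤ 27 / 10) :
    HasAreaLaw d (fundamentalRep (Fin 3)) (βW / 3) := by
  have hd1 : (0 : ℝ) ≤ (d : ℝ) - 1 := by
    have : (2 : ℝ) ≤ d := by exact_mod_cast hd
    linarith
  have h3 : ((3 : ℕ) : ℝ) * (βW / 9) = βW / 3 := by push_cast; ring
  rw [← h3]
  have hmod := oneLinkKRModulus_of_poincare_of_varianceBound (N := 3) (by norm_num) (by norm_num) hP hv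
  refine hasAreaLaw_of_oneLinkKRModulus (durhuusFrohlich_areaLaw_of_slabClustering_holds (d := d) (N := 3)) hd (by norm_num)
    (β := βW / 9) (R := 3 / 5) (K := Real.sqrt (4 / 5 * (17 / 5))) (by positivity) (Real.sqrt_nonneg _) ?_ hmod ?_
  · -- radius: (βW/9)·2(d−1) ≤ 3/5
    nlinarith
  · -- door: 2(d−1)·(βW/9)·√(68/25) ≤ (3/5)(33/20) = 99/100 < 1 (`√(68/25) ≤ 33/20` is
    -- `StarSU3Certified.sqrt_fourFifths_mul_seventeenFifths_le` in the star stack; re-derived inline to keep this leaf's imports slab-only)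
    have hs : Real.sqrt (4 / 5 * (17 / 5)) ≤ 33 / 20 := by
      rw [Real.sqrt_le_left (by norm_num)]; norm_num
    have hR : 2 * ((d : ℝ) - 1) * (βW / 9) ≤ 3 / 5 := by nlinarith
    have h0 : 0 ≤ 2 * ((d : ℝ) - 1) * (βW / 9) := by positivity
    calc 2 * ((d : ℝ) - 1) * (βW / 9) * Real.sqrt (4 / 5 * (17 / 5))
        ≤ 3 / 5 * (33 / 20) := mul_le_mul hR hs (Real.sqrt_nonneg _) (by norm_num)
      _ < 1 := by norm_num

/-- The same with the threshold written as `β_W ≤ 27/(10(d−1))`. [cite: CaoNissimSheffield2025dynamical, Theorems 1.6 and 2.3] -/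
theorem su3_hasAreaLaw_dim_of_nineTenths_pair' {d : ℕ} (hd : 2 ≤ d) (hP : OneLinkPoincareSUN 3 (3 / 5) (4 / 5))
    (hv : OneLinkVarianceBound 3 (3 / 5) (17 / 5)) {βW : ℝ} (hβ : 0 ≤ βW) (hle : βW ≤ 27 / (10 * ((d : ℝ) - 1))) :
    HasAreaLaw d (fundamentalRep (Fin 3)) (βW / 3) := by
  have hd1 : (0 : ℝ) < (d : ℝ) - 1 := by
    have : (2 : ℝ) ≤ d := by exact_mod_cast hd
    linarith
  refine su3_hasAreaLaw_dim_of_nineTenths_pair hd hP hv hβ ?_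
  have := (le_div_iff₀ (by positivity : (0 : ℝ) < 10 * ((d : ℝ) - 1))).1 hle
  linarith

/-- **`SU(3)`, `d = 3`: Wilson AREA LAW for every `0 ≤ β_W ≤ 27/20 = 1.35`**, conditional on the radius-`3/5` pair (tree row on the variance
certificate alone: `33/40`; printed CNS: `9/16`). [cite: CaoNissimSheffield2025dynamical, Theorems 1.6 and 2.3] -/
theorem su3_hasAreaLaw_d3_of_nineTenths_pair (hP : OneLinkPoincareSUN 3 (3 / 5) (4 / 5))
    (hv : OneLinkVarianceBound 3 (3 / 5) (17 / 5)) {βW : ℝ} (hβ : 0 ≤ βW) (hle : βW ≤ 27 / 20) :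
    HasAreaLaw 3 (fundamentalRep (Fin 3)) (βW / 3) :=
  su3_hasAreaLaw_dim_of_nineTenths_pair (by norm_num) hP hv hβ (by push_cast; linarith)

/-- **`SU(3)`, `d = 5`: Wilson AREA LAW for every `0 ≤ β_W ≤ 27/40`**, conditional on the radius-`3/5` pair (tree row on the variance
certificate alone: `33/80`; printed CNS: `9/32`). [cite: CaoNissimSheffield2025dynamical, Theorems 1.6 and 2.3] -/
theorem su3_hasAreaLaw_d5_of_nineTenths_pair (hP : OneLinkPoincareSUN 3 (3 / 5) (4 / 5))
    (hv : OneLinkVarianceBound 3 (3 / 5) (17 / 5)) {βW : ℝ} (hβ : 0 ≤ βW) (hle : βW ≤ 27 / 40) :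
    HasAreaLaw 5 (fundamentalRep (Fin 3)) (βW / 3) :=
  su3_hasAreaLaw_dim_of_nineTenths_pair (by norm_num) hP hv hβ (by push_cast; linarith)

/-- Numbers: `(33/20)² ≥ 68/25` (modulus), slab constant at the cap `(3/5)(33/20) = 99/100 < 1`, the exact reach of the door with `K = √(68/25)`
lies beyond the radius cap (`(3/5)²·(68/25) = 612/625 < 1`), the rows `27/(10(d−1))` at `d = 3, 4, 5, 6` against the variance-only rows
`33/(20(d−1))` and the printed `9/(8(d−1))` (ratio `12/5` in every `d`). [folklore] -/
theorem radiusDimensions_numbers :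
    (68 / 25 : ℝ) ≤ (33 / 20) ^ 2 ∧ (3 / 5 : ℝ) * (33 / 20) = 99 / 100 ∧ (99 / 100 : ℝ) < 1 ∧
      (3 / 5 : ℝ) ^ 2 * (68 / 25) = 612 / 625 ∧ (612 / 625 : ℝ) < 1 ∧
      (27 : ℝ) / (10 * (3 - 1)) = 27 / 20 ∧ (27 : ℝ) / (10 * (4 - 1)) = 9 / 10 ∧ (27 : ℝ) / (10 * (5 - 1)) = 27 / 40 ∧
      (27 : ℝ) / (10 * (6 - 1)) = 27 / 50 ∧
      (33 / 40 : ℝ) < 27 / 20 ∧ (11 / 20 : ℝ) < 9 / 10 ∧ (33 / 80 : ℝ) < 27 / 40 ∧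
      (27 / 20 : ℝ) / (9 / 16) = 12 / 5 ∧ (9 / 10 : ℝ) / (3 / 8) = 12 / 5 ∧ (27 / 40 : ℝ) / (9 / 32) = 12 / 5 := by
  norm_num

end Summit.Ventures.YMGap.SlabSU3RadiusDim

end
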